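import Mathlib
import HarnessLib

/-!
# Route RamseyUncertifiable, crux `PaleySosRung` (stmt-PneNP-9817), line `weil-patch-transfer`:
# even moments of star sums in a small-bias family (helpers for `stub_smallBiasCodegrees`, part 2)

The probabilistic core of the stub `stub_smallBiasCodegrees`. A finite family
`H : ι → SimpleGraph (Fin m)` is `k`-wise `m^{-k}`-biased when every nonempty set `E` of at most
`k` ordered pairs `e.1 < e.2` has `|Σ_i Π_{e ∈ E} s_i(e)| ≤ |ι| / m^k`
(`s_i(u,v) = +1` if `u ∼ v` in `H i`, else `-1`). For a nonempty vertex set `Q` and the star sums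
`S_i = Σ_{w ∉ V} Π_{x ∈ Q} s_i(x,w)` (`Q ⊆ V`), the `n`-th moment `Σ_i S_i^n` (`n = 2h`) expands
over tuples `w : Fin n → univ \ V`; for a fixed tuple the product of signs collapses, using
`s² = 1`, to the signed pattern of the DISTINCT pairs `{x, u}` (`x ∈ Q`, `u` a value of `w` of
odd multiplicity) (`exists_pairs`), so the family sum is `|ι|` when every value of `w` has even
multiplicity (then `w` has at most `h` distinct values: at most `h^n m^h` tuples,
`card_le_of_image_card_le`) and at most `|ι|/m^k` otherwise. This gives the classical
Füredi–Komlós type bound `Σ_i S_i^n ≤ |ι| (h^n m^h + 1)` (`sum_pow_starSum_le`) and, by Markov,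
the counting bound `sbc_badCount` on the indices with `|S_i| ≥ θ`. No definitions are
introduced. [folklore; Füredi–Komlós 1981 (the even-sequence count)]
-/

set_option linter.dupNamespace false -- `Summit.PneNP.PneNP.…`: summit = sub-problem (D-0017)

namespace Summit.PneNP.PneNP.Theorems.PaleySosRungWeilPatch

open Finset

/-- A `±1`-valued quantity raised to the power `c` is itself or `1` according to the parity of
`c`. [folklore] -/
theorem ite_pow_eq_ite_odd (P : Prop) [Decidable P] (c : ℕ) :
    (if P then (1 : ℝ) else -1) ^ c = if Odd c then (if P then (1 : ℝ) else -1) else 1 := by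
  by_cases hP : P
  · simp [hP]
  · rcases Nat.even_or_odd c with hc | hc
    · simp [hP, hc.neg_one_pow, Nat.not_odd_iff_even.2 hc]
    · simp [hP, hc.neg_one_pow, hc]

/-- Functions `Fin n → Fin m` whose image has at most `h` elements number at most `h^n · m^h`:
such a function factors as `v ∘ f` with `f : Fin n → Fin h`, `v : Fin h → Fin m`. [folklore] -/
theorem card_le_of_image_card_le {n m h : ℕ} (hm : 0 < m) (W : Finset (Fin n → Fin m))
    (hW : ∀ w ∈ W, (univ.image w).card ≤ h) : W.card ≤ h ^ n * m ^ h := by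
  let φ : (Fin n → Fin h) × (Fin h → Fin m) → (Fin n → Fin m) := fun p => p.2 ∘ p.1
  have hsub : W ⊆ (univ : Finset ((Fin n → Fin h) × (Fin h → Fin m))).image φ := by
    intro w hw
    have hT : (univ.image w).card ≤ h := hW w hw
    set T : Finset (Fin m) := univ.image w with hT_def
    let e : Fin T.card ≃o T := T.orderIsoOfFin rfl
    have hmem : ∀ l, w l ∈ T := fun l => mem_image_of_mem w (mem_univ l)
    let f : Fin n → Fin h := fun l => Fin.castLE hT (e.symm ⟨w l, hmem l⟩)
    let v : Fin h → Fin m := fun j =>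
      if hj : (j : ℕ) < T.card then ((e ⟨j, hj⟩ : T) : Fin m) else ⟨0, hm⟩
    refine mem_image.2 ⟨(f, v), mem_univ _, ?_⟩
    funext l
    show v (f l) = w l
    have hlt : ((f l : Fin h) : ℕ) < T.card := by
      show ((e.symm ⟨w l, hmem l⟩ : Fin T.card) : ℕ) < T.card
      exact Fin.is_lt _
    have hfl : (⟨((f l : Fin h) : ℕ), hlt⟩ : Fin T.card) = e.symm ⟨w l, hmem l⟩ := Fin.ext rfl
    simp only [v, dif_pos hlt, hfl, OrderIso.apply_symm_apply]
  calc W.card ≤ ((univ : Finset ((Fin n → Fin h) × (Fin h → Fin m))).image φ).card :=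
        card_le_card hsub
    _ ≤ (univ : Finset ((Fin n → Fin h) × (Fin h → Fin m))).card := card_image_le
    _ = h ^ n * m ^ h := by simp

/-- If every value of `w : Fin n → Fin m` is taken an even number of times, then `w` takes at
most `n / 2` distinct values. [folklore] -/
theorem two_mul_card_image_le {n m : ℕ} (w : Fin n → Fin m)
    (hw : ∀ u ∈ univ.image w, ¬ Odd ((univ.filter fun l => w l = u).card)) :
    2 * (univ.image w).card ≤ n := by
  have hn : (univ : Finset (Fin n)).card =
      ∑ u ∈ univ.image w, (univ.filter fun l => w l = u).card :=
    card_eq_sum_card_image w univ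
  have h2 : ∀ u ∈ univ.image w, 2 ≤ (univ.filter fun l => w l = u).card := by
    intro u hu
    have hpos : 0 < (univ.filter fun l => w l = u).card := by
      obtain ⟨l, -, rfl⟩ := mem_image.1 hu
      exact card_pos.2 ⟨l, by simp⟩
    obtain ⟨c, hc⟩ := Nat.not_odd_iff_even.1 (hw u hu)
    omega
  calc 2 * (univ.image w).card = ∑ u ∈ univ.image w, 2 := by rw [sum_const, smul_eq_mul, mul_comm]
    _ ≤ ∑ u ∈ univ.image w, (univ.filter fun l => w l = u).card := sum_le_sum h2
    _ = n := by rw [← hn, card_univ, Fintype.card_fin]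

/-- **Parity reduction of a tuple of star characters.** For a nonempty `Q` and a tuple
`w : Fin n → Fin m` of centres outside `Q` there is a set `E` of ordered pairs `e.1 < e.2`,
`|E| ≤ |Q|·n`, such that for EVERY graph `G` the product `Π_l Π_{x∈Q} s_G(x, w_l)` equals the
signed pattern `Π_{e∈E} s_G(e.1, e.2)`; namely `E = {(min x u, max x u) : x ∈ Q, u a value of w of
odd multiplicity}` (squares of signs are `1`). If `E = ∅` then every value of `w` has even
multiplicity, so `w` takes at most `n/2` values. [folklore] -/
theorem exists_pairs {m n : ℕ} (Q : Finset (Fin m)) (hQ : Q.Nonempty) (w : Fin n → Fin m)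
    (hw : ∀ l, w l ∉ Q) :
    ∃ E : Finset (Fin m × Fin m), (∀ e ∈ E, e.1 < e.2) ∧ E.card ≤ Q.card * n ∧
      (E = ∅ → 2 * (univ.image w).card ≤ n) ∧
      ∀ (G : SimpleGraph (Fin m)) [DecidableRel G.Adj],
        ∏ l, ∏ x ∈ Q, (if G.Adj x (w l) then (1 : ℝ) else -1) =
          ∏ e ∈ E, (if G.Adj e.1 e.2 then (1 : ℝ) else -1) := by
  set mult : Fin m → ℕ := fun u => (univ.filter fun l => w l = u).card with hmult
  set Oddw : Finset (Fin m) := (univ.image w).filter (fun u => Odd (mult u)) with hOddw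
  set mm : Fin m × Fin m → Fin m × Fin m := fun p => (min p.1 p.2, max p.1 p.2) with hmm
  have hOdd_sub : ∀ u ∈ Oddw, u ∉ Q := by
    intro u hu
    obtain ⟨l, -, rfl⟩ := mem_image.1 (mem_of_mem_filter u hu)
    exact hw l
  have hne : ∀ p ∈ Q ×ˢ Oddw, p.1 ≠ p.2 := by
    intro p hp h
    rw [mem_product] at hp
    exact hOdd_sub p.2 hp.2 (h ▸ hp.1)
  have hinj : Set.InjOn mm ↑(Q ×ˢ Oddw) := by
    intro p hp p' hp' hpp'
    simp only [hmm, Prod.mk.injEq] at hpp'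
    obtain ⟨hmin, hmax⟩ := hpp'
    have hp1 : p.1 ∈ Q := (mem_product.1 hp).1
    have hp'1 : p'.1 ∈ Q := (mem_product.1 hp').1
    have hp2 : p.2 ∉ Q := hOdd_sub _ (mem_product.1 hp).2
    have hp'2 : p'.2 ∉ Q := hOdd_sub _ (mem_product.1 hp').2
    rcases le_total p.1 p.2 with h1 | h1 <;> rcases le_total p'.1 p'.2 with h2 | h2
    · rw [min_eq_left h1, min_eq_left h2] at hmin
      rw [max_eq_right h1, max_eq_right h2] at hmax
      exact Prod.ext hmin hmax
    · rw [min_eq_left h1, min_eq_right h2] at hmin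
      rw [hmin] at hp1
      exact absurd hp1 hp'2
    · rw [min_eq_right h1, min_eq_left h2] at hmin
      rw [← hmin] at hp'1
      exact absurd hp'1 hp2
    · rw [min_eq_right h1, min_eq_right h2] at hmin
      rw [max_eq_left h1, max_eq_left h2] at hmax
      exact Prod.ext hmax hmin
  refine ⟨(Q ×ˢ Oddw).image mm, ?_, ?_, ?_, ?_⟩
  · intro e he
    obtain ⟨p, hp, rfl⟩ := mem_image.1 he
    exact min_lt_max.2 (hne p hp)
  · calc ((Q ×ˢ Oddw).image mm).card ≤ (Q ×ˢ Oddw).card := card_image_le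
      _ = Q.card * Oddw.card := card_product _ _
      _ ≤ Q.card * n := by
        refine Nat.mul_le_mul_left _ ?_
        calc Oddw.card ≤ (univ.image w).card := card_filter_le _ _
          _ ≤ (univ : Finset (Fin n)).card := card_image_le
          _ = n := by rw [card_univ, Fintype.card_fin]
  · intro hE
    apply two_mul_card_image_le
    intro u hu hodd
    have huO : u ∈ Oddw := mem_filter.2 ⟨hu, hodd⟩
    obtain ⟨x, hx⟩ := hQ
    have : mm (x, u) ∈ (Q ×ˢ Oddw).image mm := mem_image_of_mem _ (mem_product.2 ⟨hx, huO⟩)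
    rw [hE] at this
    exact notMem_empty _ this
  · intro G _
    rw [prod_image hinj, prod_product]
    refine prod_comm.trans (prod_congr rfl fun x _ => ?_)
    have step1 : ∏ l, (if G.Adj x (w l) then (1 : ℝ) else -1) =
        ∏ u ∈ univ.image w, (if G.Adj x u then (1 : ℝ) else -1) ^ mult u :=
      prod_comp (fun u => if G.Adj x u then (1 : ℝ) else -1) w
    rw [step1, hOddw, prod_filter]
    refine prod_congr rfl fun u _ => ?_
    rw [ite_pow_eq_ite_odd]
    congr 1
    simp only [hmm]
    rcases le_total x u with hxu | hxu
    · rw [min_eq_left hxu, max_eq_right hxu]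
    · rw [min_eq_right hxu, max_eq_left hxu]
      simp only [G.adj_comm]

/-- For a tuple `w` of centres outside the nonempty set `Q` (`|Q|·n ≤ k`) and a `k`-wise
`m^{-k}`-biased family, the family sum of `Π_l Π_{x∈Q} s_i(x, w_l)` is at most
`|ι|·1[w takes ≤ n/2 values] + |ι|/m^k`. [folklore] -/
theorem sum_prod_prod_le {m : ℕ} {ι : Type*} [Fintype ι] (H : ι → SimpleGraph (Fin m))
    [∀ i, DecidableRel (H i).Adj] (k : ℕ)
    (hbias : ∀ E : Finset (Fin m × Fin m), E.Nonempty → E.card ≤ k → (∀ e ∈ E, e.1 < e.2) →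
      |∑ i, ∏ e ∈ E, (if (H i).Adj e.1 e.2 then (1 : ℝ) else -1)| ≤
        (Fintype.card ι : ℝ) / (m : ℝ) ^ k)
    {n : ℕ} (Q : Finset (Fin m)) (hQ : Q.Nonempty) (hQk : Q.card * n ≤ k)
    (w : Fin n → Fin m) (hw : ∀ l, w l ∉ Q) :
    ∑ i, ∏ l, ∏ x ∈ Q, (if (H i).Adj x (w l) then (1 : ℝ) else -1) ≤
      (if 2 * (univ.image w).card ≤ n then (Fintype.card ι : ℝ) else 0) +
        (Fintype.card ι : ℝ) / (m : ℝ) ^ k := by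
  obtain ⟨E, hElt, hEcard, hEempty, hEprod⟩ := exists_pairs Q hQ w hw
  have hdiv : 0 ≤ (Fintype.card ι : ℝ) / (m : ℝ) ^ k := by positivity
  have hif : 0 ≤ (if 2 * (univ.image w).card ≤ n then (Fintype.card ι : ℝ) else 0) := by
    split_ifs <;> positivity
  rw [sum_congr rfl fun i _ => hEprod (H i)]
  by_cases hE : E = ∅
  · rw [if_pos (hEempty hE), hE]
    simp only [prod_empty, sum_const, card_univ, nsmul_eq_mul, mul_one]
    linarith
  · have hb := hbias E (nonempty_iff_ne_empty.2 hE) (hEcard.trans hQk) hElt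
    calc ∑ i, ∏ e ∈ E, (if (H i).Adj e.1 e.2 then (1 : ℝ) else -1)
        ≤ |∑ i, ∏ e ∈ E, (if (H i).Adj e.1 e.2 then (1 : ℝ) else -1)| := le_abs_self _
      _ ≤ (Fintype.card ι : ℝ) / (m : ℝ) ^ k := hb
      _ ≤ _ := le_add_of_nonneg_left hif

/-- **Even-moment bound for star sums of a small-bias family** (Füredi–Komlós count): for
`n = 2h ≤ k`, `1 ≤ m`, a nonempty `Q ⊆ V` with `|Q|·n ≤ k`,
`Σ_i (Σ_{w ∉ V} Π_{x∈Q} s_i(x,w))^n ≤ |ι|·(h^n m^h + 1)`. [folklore] -/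
theorem sum_pow_starSum_le {m : ℕ} {ι : Type*} [Fintype ι] (H : ι → SimpleGraph (Fin m))
    [∀ i, DecidableRel (H i).Adj] (k : ℕ)
    (hbias : ∀ E : Finset (Fin m × Fin m), E.Nonempty → E.card ≤ k → (∀ e ∈ E, e.1 < e.2) →
      |∑ i, ∏ e ∈ E, (if (H i).Adj e.1 e.2 then (1 : ℝ) else -1)| ≤
        (Fintype.card ι : ℝ) / (m : ℝ) ^ k)
    {n h : ℕ} (hn : n = 2 * h) (hnk : n ≤ k) (hm : 1 ≤ m)
    (Q V : Finset (Fin m)) (hQV : Q ⊆ V) (hQ : Q.Nonempty) (hQk : Q.card * n ≤ k) :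
    ∑ i, (∑ w ∈ univ \ V, ∏ x ∈ Q, (if (H i).Adj x w then (1 : ℝ) else -1)) ^ n ≤
      (Fintype.card ι : ℝ) * ((h : ℝ) ^ n * (m : ℝ) ^ h + 1) := by
  set U : Finset (Fin m) := univ \ V with hU
  set T : Finset (Fin n → Fin m) := Fintype.piFinset fun _ : Fin n => U with hT
  -- expand the power over tuples
  have hexp : ∀ i, (∑ w ∈ U, ∏ x ∈ Q, (if (H i).Adj x w then (1 : ℝ) else -1)) ^ n =
      ∑ ω ∈ T, ∏ l, ∏ x ∈ Q, (if (H i).Adj x (ω l) then (1 : ℝ) else -1) := by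
    intro i
    rw [← Fin.prod_const n, prod_univ_sum]
  rw [sum_congr rfl fun i _ => hexp i, sum_comm]
  -- per-tuple bound
  have hωQ : ∀ ω ∈ T, ∀ l, ω l ∉ Q := by
    intro ω hω l hl
    have hωl : ω l ∈ U := Fintype.mem_piFinset.1 hω l
    rw [hU, mem_sdiff] at hωl
    exact hωl.2 (hQV hl)
  have hle : ∀ ω ∈ T, ∑ i, ∏ l, ∏ x ∈ Q, (if (H i).Adj x (ω l) then (1 : ℝ) else -1) ≤
      (if 2 * (univ.image ω).card ≤ n then (Fintype.card ι : ℝ) else 0) +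
        (Fintype.card ι : ℝ) / (m : ℝ) ^ k :=
    fun ω hω => sum_prod_prod_le H k hbias Q hQ hQk ω (hωQ ω hω)
  refine (sum_le_sum hle).trans ?_
  rw [sum_add_distrib, sum_const, nsmul_eq_mul, ← sum_filter, sum_const, nsmul_eq_mul]
  -- the two counts
  have hcount : ((T.filter fun ω => 2 * (univ.image ω).card ≤ n).card : ℝ) ≤
      (h : ℝ) ^ n * (m : ℝ) ^ h := by
    have hm0 : 0 < m := hm
    exact_mod_cast card_le_of_image_card_le hm0 _ (fun ω hω => by
      have := (mem_filter.1 hω).2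
      omega)
  have hTcard : (T.card : ℝ) ≤ (m : ℝ) ^ k := by
    have h1 : T.card ≤ m ^ n := by
      rw [hT, Fintype.card_piFinset, prod_const, card_univ, Fintype.card_fin]
      exact Nat.pow_le_pow_left ((card_le_univ U).trans (by simp)) n
    have h2 : (m : ℝ) ^ n ≤ (m : ℝ) ^ k := pow_le_pow_right₀ (by exact_mod_cast hm) hnk
    exact le_trans (by exact_mod_cast h1) h2
  have hmk : (T.card : ℝ) * ((Fintype.card ι : ℝ) / (m : ℝ) ^ k) ≤ (Fintype.card ι : ℝ) := by
    have hmpos : (0 : ℝ) < (m : ℝ) ^ k := by positivity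
    rw [mul_div_assoc', div_le_iff₀ hmpos]
    have hc : (0 : ℝ) ≤ (Fintype.card ι : ℝ) := Nat.cast_nonneg _
    nlinarith
  have hc : (0 : ℝ) ≤ (Fintype.card ι : ℝ) := Nat.cast_nonneg _
  calc ((T.filter fun ω => 2 * (univ.image ω).card ≤ n).card : ℝ) * (Fintype.card ι : ℝ) +
        (T.card : ℝ) * ((Fintype.card ι : ℝ) / (m : ℝ) ^ k)
      ≤ (h : ℝ) ^ n * (m : ℝ) ^ h * (Fintype.card ι : ℝ) + (Fintype.card ι : ℝ) :=
        add_le_add (mul_le_mul_of_nonneg_right hcount hc) hmk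
    _ = (Fintype.card ι : ℝ) * ((h : ℝ) ^ n * (m : ℝ) ^ h + 1) := by ring

/-- Markov's inequality in counting form for an even moment: if `θ ≤ |f i|` on `Bad` (`θ ≥ 0`,
`n` even) then `|Bad|·θ^n ≤ Σ_i f_i^n`. [folklore] -/
theorem card_mul_pow_le_sum_pow {ι : Type*} [Fintype ι] (f : ι → ℝ) {n : ℕ} (hn : Even n)
    {θ : ℝ} (hθ : 0 ≤ θ) (Bad : Finset ι) (hBad : ∀ i ∈ Bad, θ ≤ |f i|) :
    (Bad.card : ℝ) * θ ^ n ≤ ∑ i, f i ^ n := by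
  calc (Bad.card : ℝ) * θ ^ n = ∑ _i ∈ Bad, θ ^ n := by rw [sum_const, nsmul_eq_mul]
    _ ≤ ∑ i ∈ Bad, f i ^ n := sum_le_sum fun i hi => by
        rw [← hn.pow_abs (f i)]
        exact pow_le_pow_left₀ hθ (hBad i hi) n
    _ ≤ ∑ i, f i ^ n := sum_le_univ_sum_of_nonneg fun i => hn.pow_nonneg _

/-- **Registered sub-goal `sbc_badCount`** (credits this helper file to stmt-PneNP-9817): for a
`k`-wise `m^{-k}`-biased family, `n = 2h ≤ k`, `1 ≤ m`, a nonempty `Q ⊆ V` with `|Q|·n ≤ k` and a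
threshold `θ ≥ 0`, every set `Bad` of indices with `θ ≤ |Σ_{w ∉ V} Π_{x∈Q} s_i(x,w)|` satisfies
`|Bad|·θ^n ≤ |ι|·(h^n m^h + 1)` (moment bound + Markov). [folklore] -/
theorem sbc_badCount :
    ∀ {m : ℕ} {ι : Type*} [Fintype ι] (H : ι → SimpleGraph (Fin m))
      [∀ i, DecidableRel (H i).Adj] (k n h : ℕ), n = 2 * h → n ≤ k → 1 ≤ m →
      (∀ E : Finset (Fin m × Fin m), E.Nonempty → E.card ≤ k → (∀ e ∈ E, e.1 < e.2) →
        |∑ i, ∏ e ∈ E, (if (H i).Adj e.1 e.2 then (1 : ℝ) else -1)| ≤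
          (Fintype.card ι : ℝ) / (m : ℝ) ^ k) →
      ∀ (Q V : Finset (Fin m)), Q ⊆ V → Q.Nonempty → Q.card * n ≤ k → ∀ (θ : ℝ), 0 ≤ θ →
      ∀ (Bad : Finset ι),
        (∀ i ∈ Bad, θ ≤ |∑ w ∈ Finset.univ \ V, ∏ x ∈ Q, (if (H i).Adj x w then (1 : ℝ) else -1)|) →
        (Bad.card : ℝ) * θ ^ n ≤ (Fintype.card ι : ℝ) * ((h : ℝ) ^ n * (m : ℝ) ^ h + 1) := by
  intro m ι _ H _ k n h hn hnk hm hbias Q V hQV hQ hQk θ hθ Bad hBad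
  exact (card_mul_pow_le_sum_pow _ ⟨h, by omega⟩ hθ Bad hBad).trans
    (sum_pow_starSum_le H k hbias hn hnk hm Q V hQV hQ hQk)

end Summit.PneNP.PneNP.Theorems.PaleySosRungWeilPatch
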